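import Mathlib.Probability.Distributions.Gaussian.Multivariate
import Mathlib.Probability.Distributions.Gaussian.HasGaussianLaw.Basic
import Mathlib.Analysis.InnerProductSpace.Projection.Reflection
import Literature.Analysis.Convexity.PrekopaLeindler
import Literature.Probability.Distributions.GaussianPiDensity
import HarnessLib

/-!
# The Khatri–Šidák inequality (Gaussian correlation for slabs) and Šidák's product inequality

statement-level skeleton of published theorems with citation tags; proofs where landed; nothing here is a claim about
the Yang–Mills mass gap (cell `lit-balaban` page-1 framing sentence — this is a classical support file of that cell, unit
`lit-balaban-p24`; sentence added in a docstring-only revision, referee N1 census gen 70; declarations byte-identical).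

`Literature/Probability/Distributions/`.  For a centred Gaussian vector `X = (g₁, …, g_k)` and thresholds
`p₁, …, p_k`:  `P(|gᵢ| ≤ pᵢ ∀ i) ≥ ∏ᵢ P(|gᵢ| ≤ pᵢ)` — Z. Šidák, *Rectangular confidence regions for the means of
multivariate normal distributions*, J. Amer. Statist. Assoc. **62** (1967) 626–633, Corollary 1 [Sidak1967]
(independently C. G. Khatri 1967), PROVED here (no named facts), following the printed route of E. Giné, R. Nickl,
*Mathematical Foundations of Infinite-Dimensional Statistical Models* (CUP 2016/2021) [GineNickl2021] §2.4.1: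

* Thm 2.4.2 (Prékopa–Leindler) — in the tree: `Literature.Analysis.Convexity.PrekopaLeindler.prekopaLeindler_pi`;
  transported to the product standard Gaussian `⊗ⁿ N(0,1)` on `Fin n → ℝ` (`prekopaLeindler_piGaussian`, the
  Gaussian density being log-concave — the "(2.52)" step of the proof of GN Thm 2.4.3);
* Thm 2.4.3 (log-concavity of Gaussian measure) in the form used downstream: for a convex measurable
  `D ⊆ ℝ × ℝᵐ`, `t ↦ ⊗ᵐN(0,1)(D_t)` is log-concave (`measure_section_logConcave`), and, for `D` symmetric, even
  and non-increasing in `|t|` (`measure_section_antitone`, GN Exercise 2.4.5); Anderson's lemma GN Thm 2.4.4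
  [Anderson1955] for `X = A·Z`, `Z ~ ⊗ⁿN(0,1)`, and symmetric convex `K`: `P(X + y ∈ K) ≤ P(X ∈ K)`
  (`anderson_piGaussian`);
* GN Exercise 2.4.6 / Cor. 2.4.6 (Khatri–Šidák): `P(|⟨u,Z⟩| ≤ c, |⟨aⱼ,Z⟩| ≤ dⱼ ∀ j) ≥ P(|⟨u,Z⟩| ≤ c)·P(|⟨aⱼ,Z⟩| ≤ dⱼ ∀ j)`
  for `Z ~ ⊗ⁿN(0,1)` and arbitrary vectors `u, aⱼ` (`khatriSidak_pi`).  DEVIATION from print (recorded): Mathlib has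
  no conditional densities, so the regression `Y = a g₀ + Z` of GN Ex. 2.4.6 is realised on the product space — a
  rotation taking `u/‖u‖` to the first basis vector (`Submodule.reflection_sub`, `stdGaussian_map`) followed by Tonelli
  at coordinate `0` (`measurePreserving_piFinSuccAbove`) — and the derivative-of-`f/g` step of the printed proof of
  Cor. 2.4.6 is replaced by the equivalent monotone comparison `∫_{|t|≤c} φ ≥ P(|t| ≤ c)·∫ φ` for `φ` non-increasing
  in `|t|` (`setLIntegral_abs_le_ge`, = GN Ex. 2.4.6 "`P{Y ∈ C | |g₀| ≤ t} ≥ P{Y ∈ C | g₀ = t}`");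
* iteration (`sidak_pi`) and the form for Mathlib's `multivariateGaussian 0 S` with coordinate slabs
  (`sidak_multivariateGaussian`, `sidak_multivariateGaussian_real`) — exactly the shape of the named fact
  `…Balaban1983to89.GaussianSmallField.SidakInequality`, discharged in the sibling
  `…Balaban1983to89.GaussianSmallFieldSidak`.

Theorems only; no `sorry`, no new axioms.  Unit `lit-balaban-p24` (gen 5), HOME `run/shared/lean/pub/lit-balaban/`.

v1.1 (same unit; append-only — every v1 declaration byte-identical): Part G, the statements AS PRINTED for "jointly
normal centred random variables": a centred Gaussian measure on `EuclideanSpace ℝ (Fin k)` is `multivariateGaussian 0 S`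
for its covariance matrix (private, via Mathlib's `IsGaussian.ext`), hence `sidak_of_isGaussian`,
`khatriSidak_multivariateGaussian`, `khatriSidak_of_isGaussian`, and — for real random variables `X₁,…,X_k` on a
probability space whose vector has Gaussian law (Mathlib `HasGaussianLaw`) and mean zero — `sidak_of_hasGaussianLaw`
(`∏ᵢ P(|Xᵢ| ≤ pᵢ) ≤ P(|Xᵢ| ≤ pᵢ ∀ i)`, [Sidak1967] Cor. 1 verbatim) and `khatriSidak_of_hasGaussianLaw` (GN Cor. 2.4.6,
first display).  New import: `Mathlib.Probability.Distributions.Gaussian.HasGaussianLaw.Basic`.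

v1.2 (same unit; append-only): Part H, Anderson's lemma AS PRINTED (GN Thm 2.4.4 [Anderson1955]) for an arbitrary centred
Gaussian measure on `EuclideanSpace ℝ (Fin k)` and a measurable convex symmetric `C`: `μ{x | x + y ∈ C} ≤ μ(C)`
(`anderson_of_isGaussian`), with the monotone form of GN Exercise 2.4.5 (`anderson_of_isGaussian_antitone`).
-/

noncomputable section

open MeasureTheory ProbabilityTheory Set WithLp
open scoped ENNReal NNReal MatrixOrder

namespace Literature.Probability.Distributions.KhatriSidak

/-! Throughout, `Measure.pi (fun _ : Fin n => gaussianReal 0 1)` is the product standard Gaussian `⊗ⁿ N(0,1)` on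
`Fin n → ℝ` (written out in full; no notation is declared). -/

/-! ### Part A. Prékopa–Leindler for the product standard Gaussian (GN Thm 2.4.3, step (2.52)) -/

/-- Log-concavity of the unnormalised Gaussian density `e^{-(∑ xᵢ²/2)/v}` in the `ℝ≥0∞` form needed by
Prékopa–Leindler: `ρ(x)^{1-s} ρ(y)^s ≤ ρ((1-s)x + sy)` ("it is easy to see … that `x ↦ log φ(x)` is concave",
GN p. 49). [cite: GineNickl2021, Theorem 2.4.3 (2.52)] -/
theorem gaussDensity_logConcave (n : ℕ) (v : ℝ≥0) {s : ℝ} (hs0 : 0 ≤ s) (hs1 : s ≤ 1) (x y : Fin n → ℝ) :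
    ENNReal.ofReal (Real.exp (-(∑ i, x i ^ 2 / 2) / v)) ^ (1 - s) *
        ENNReal.ofReal (Real.exp (-(∑ i, y i ^ 2 / 2) / v)) ^ s ≤
      ENNReal.ofReal (Real.exp (-(∑ i, ((1 - s) • x + s • y) i ^ 2 / 2) / v)) := by
  have h1s : 0 ≤ 1 - s := by linarith
  rw [ENNReal.ofReal_rpow_of_nonneg (Real.exp_pos _).le h1s, ENNReal.ofReal_rpow_of_nonneg (Real.exp_pos _).le hs0,
    ← ENNReal.ofReal_mul (Real.rpow_nonneg (Real.exp_pos _).le _), ← Real.exp_mul, ← Real.exp_mul, ← Real.exp_add]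
  refine ENNReal.ofReal_le_ofReal (Real.exp_le_exp.2 ?_)
  have hv : (0 : ℝ) ≤ (v : ℝ) := v.coe_nonneg
  rcases hv.eq_or_lt with hv0 | hvpos
  · simp [← hv0]
  -- termwise convexity of the square
  have hterm : ∀ i, ((1 - s) • x + s • y) i ^ 2 ≤ (1 - s) * x i ^ 2 + s * y i ^ 2 := by
    intro i
    simp only [Pi.add_apply, Pi.smul_apply, smul_eq_mul]
    nlinarith [mul_nonneg hs0 h1s, sq_nonneg (x i - y i)]
  have hsum : ∑ i, ((1 - s) • x + s • y) i ^ 2 / 2 ≤ (1 - s) * ∑ i, x i ^ 2 / 2 + s * ∑ i, y i ^ 2 / 2 := by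
    rw [Finset.mul_sum, Finset.mul_sum, ← Finset.sum_add_distrib]
    exact Finset.sum_le_sum fun i _ => by have := hterm i; linarith
  have : -(∑ i, x i ^ 2 / 2) / ↑v * (1 - s) + -(∑ i, y i ^ 2 / 2) / ↑v * s =
      -((1 - s) * ∑ i, x i ^ 2 / 2 + s * ∑ i, y i ^ 2 / 2) / ↑v := by
    field_simp
    ring
  rw [this, neg_div, neg_div, neg_le_neg_iff]
  exact div_le_div_of_nonneg_right hsum hvpos.le

/-- **Prékopa–Leindler for the product standard Gaussian** `⊗ⁿN(0,1)` on `Fin n → ℝ`: if `f, g, h ≥ 0` are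
measurable and `h((1-s)x + sy) ≥ f(x)^{1-s} g(y)^s` (`0 < s < 1`) then `∫ h dγ ≥ (∫ f dγ)^{1-s} (∫ g dγ)^s`.
(GN Thm 2.4.2 applied to `fφ, gφ, hφ` with the log-concave Gaussian density `φ`, as in the proof of GN Thm 2.4.3.)
[cite: GineNickl2021, Theorem 2.4.3 (proof)] -/
theorem prekopaLeindler_piGaussian {n : ℕ} {s : ℝ} (hs0 : 0 < s) (hs1 : s < 1)
    {f g h : (Fin n → ℝ) → ℝ≥0∞} (hf : Measurable f) (hg : Measurable g) (hh : Measurable h)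
    (H : ∀ x y, f x ^ (1 - s) * g y ^ s ≤ h ((1 - s) • x + s • y)) :
    (∫⁻ x, f x ∂(Measure.pi fun _ : Fin n => gaussianReal (0 : ℝ) (1 : ℝ≥0))) ^ (1 - s) * (∫⁻ y, g y ∂(Measure.pi fun _ : Fin n => gaussianReal (0 : ℝ) (1 : ℝ≥0))) ^ s ≤ ∫⁻ z, h z ∂(Measure.pi fun _ : Fin n => gaussianReal (0 : ℝ) (1 : ℝ≥0)) := by
  have h1s : 0 < 1 - s := by linarith
  set ρ : (Fin n → ℝ) → ℝ≥0∞ := fun ω => ENNReal.ofReal (Real.exp (-(∑ i, ω i ^ 2 / 2) / ((1 : ℝ≥0) : ℝ)))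
    with hρ_def
  have hρm : Measurable ρ := by
    rw [hρ_def]
    fun_prop
  set c : ℝ≥0∞ := ENNReal.ofReal ((Real.sqrt (2 * Real.pi * ((1 : ℝ≥0) : ℝ)))⁻¹ ^ n) with hc_def
  have hγ : (Measure.pi fun _ : Fin n => gaussianReal (0 : ℝ) (1 : ℝ≥0)) = c • (volume : Measure (Fin n → ℝ)).withDensity ρ :=
    pi_gaussianReal_eq_smul_withDensity n one_ne_zero
  have hint : ∀ u : (Fin n → ℝ) → ℝ≥0∞, Measurable u → ∫⁻ x, u x ∂(Measure.pi fun _ : Fin n => gaussianReal (0 : ℝ) (1 : ℝ≥0)) = c * ∫⁻ x, (ρ * u) x := by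
    intro u hu
    rw [hγ, lintegral_smul_measure, lintegral_withDensity_eq_lintegral_mul _ hρm hu, smul_eq_mul]
  rw [hint f hf, hint g hg, hint h hh, ENNReal.mul_rpow_of_nonneg _ _ h1s.le, ENNReal.mul_rpow_of_nonneg _ _ hs0.le,
    mul_mul_mul_comm, ← ENNReal.rpow_add_of_nonneg _ _ h1s.le hs0.le, show (1 - s) + s = 1 by ring,
    ENNReal.rpow_one]
  refine mul_le_mul' le_rfl ?_
  refine Literature.Analysis.Convexity.prekopaLeindler_pi hs0 hs1 n (hρm.mul hf) (hρm.mul hg) (hρm.mul hh)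
    fun x y => ?_
  simp only [Pi.mul_apply]
  rw [ENNReal.mul_rpow_of_nonneg _ _ h1s.le, ENNReal.mul_rpow_of_nonneg _ _ hs0.le, mul_mul_mul_comm]
  exact mul_le_mul' (gaussDensity_logConcave n 1 hs0.le hs1.le x y) (H x y)

/-! ### Part B. Log-concavity of the Gaussian measure of the sections of a convex set; Anderson's lemma
(GN Thm 2.4.3, Thm 2.4.4, Exercise 2.4.5) -/

/-- `⊗ⁿN(0,1)` is symmetric: invariant under `x ↦ -x`. [folklore] -/
private theorem piGaussian_map_neg (n : ℕ) : ((Measure.pi fun _ : Fin n => gaussianReal (0 : ℝ) (1 : ℝ≥0))).map (fun x => -x) = (Measure.pi fun _ : Fin n => gaussianReal (0 : ℝ) (1 : ℝ≥0)) := by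
  have h : ∀ _i : Fin n, MeasurePreserving (fun x : ℝ => -x) (gaussianReal 0 1) (gaussianReal 0 1) := fun _ =>
    ⟨measurable_neg, by rw [gaussianReal_map_neg, neg_zero]⟩
  exact (measurePreserving_pi _ _ h).map_eq

/-- The `⊗ⁿN(0,1)`-measure of a set equals that of its reflection `-A`. [folklore] -/
private theorem piGaussian_neg_preimage (n : ℕ) (A : Set (Fin n → ℝ)) : (Measure.pi fun _ : Fin n => gaussianReal (0 : ℝ) (1 : ℝ≥0)) ((fun x => -x) ⁻¹' A) = (Measure.pi fun _ : Fin n => gaussianReal (0 : ℝ) (1 : ℝ≥0)) A := by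
  conv_rhs => rw [← piGaussian_map_neg n]
  exact ((MeasurableEquiv.neg (Fin n → ℝ)).map_apply A).symm

/-- **Log-concavity of the Gaussian measure of sections** (GN Thm 2.4.3 in the form used for Anderson's lemma):
for `D ⊆ ℝ × ℝᵐ` convex and measurable, with sections `D_t = {z | (t, z) ∈ D}`,
`γ(D_a)^{1-s} γ(D_b)^s ≤ γ(D_{(1-s)a+sb})` for `0 < s < 1`. [cite: GineNickl2021, Theorem 2.4.3] -/
theorem measure_section_logConcave {m : ℕ} {D : Set (ℝ × (Fin m → ℝ))} (hDc : Convex ℝ D)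
    (hDm : MeasurableSet D) {s : ℝ} (hs0 : 0 < s) (hs1 : s < 1) (a b : ℝ) :
    (Measure.pi fun _ : Fin m => gaussianReal (0 : ℝ) (1 : ℝ≥0)) (Prod.mk a ⁻¹' D) ^ (1 - s) * (Measure.pi fun _ : Fin m => gaussianReal (0 : ℝ) (1 : ℝ≥0)) (Prod.mk b ⁻¹' D) ^ s ≤ (Measure.pi fun _ : Fin m => gaussianReal (0 : ℝ) (1 : ℝ≥0)) (Prod.mk ((1 - s) * a + s * b) ⁻¹' D) := by
  have hmeas : ∀ t : ℝ, MeasurableSet (Prod.mk t ⁻¹' D) := fun _ => measurable_prodMk_left hDm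
  rw [← lintegral_indicator_one (hmeas a), ← lintegral_indicator_one (hmeas b), ← lintegral_indicator_one (hmeas _)]
  refine prekopaLeindler_piGaussian hs0 hs1 (measurable_one.indicator (hmeas a))
    (measurable_one.indicator (hmeas b)) (measurable_one.indicator (hmeas _)) fun x y => ?_
  by_cases hx : x ∈ Prod.mk a ⁻¹' D
  · by_cases hy : y ∈ Prod.mk b ⁻¹' D
    · have hxy : (1 - s) • x + s • y ∈ Prod.mk ((1 - s) * a + s * b) ⁻¹' D := by
        have hmem := hDc hx hy (by linarith : (0 : ℝ) ≤ 1 - s) hs0.le (by ring)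
        simpa only [mem_preimage, Prod.smul_mk, Prod.mk_add_mk, smul_eq_mul] using hmem
      rw [indicator_of_mem hx, indicator_of_mem hy, indicator_of_mem hxy]
      simp
    · rw [indicator_of_notMem hy, ENNReal.zero_rpow_of_pos hs0, mul_zero]
      exact bot_le
  · rw [indicator_of_notMem hx, ENNReal.zero_rpow_of_pos (by linarith : 0 < 1 - s), zero_mul]
    exact bot_le

/-- **Monotonicity of the Gaussian measure of sections** (GN Exercise 2.4.5): for `D ⊆ ℝ × ℝᵐ` convex, measurable
and symmetric (`p ∈ D → -p ∈ D`), `t ↦ γ(D_t)` is non-increasing on `[0, ∞)`.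
[cite: GineNickl2021, Exercise 2.4.5] -/
theorem measure_section_antitone {m : ℕ} {D : Set (ℝ × (Fin m → ℝ))} (hDc : Convex ℝ D)
    (hDm : MeasurableSet D) (hDs : ∀ p ∈ D, -p ∈ D) {t₁ t₂ : ℝ} (h0 : 0 ≤ t₁) (h12 : t₁ ≤ t₂) :
    (Measure.pi fun _ : Fin m => gaussianReal (0 : ℝ) (1 : ℝ≥0)) (Prod.mk t₂ ⁻¹' D) ≤ (Measure.pi fun _ : Fin m => gaussianReal (0 : ℝ) (1 : ℝ≥0)) (Prod.mk t₁ ⁻¹' D) := by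
  rcases h12.eq_or_lt with rfl | hlt
  · exact le_rfl
  have ht₂ : 0 < t₂ := lt_of_le_of_lt h0 hlt
  set s : ℝ := (t₂ - t₁) / (2 * t₂) with hs_def
  have hs0 : 0 < s := div_pos (by linarith) (by linarith)
  have hs1 : s < 1 := by
    rw [hs_def, div_lt_one (by linarith)]
    linarith
  have hcomb : (1 - s) * t₂ + s * (-t₂) = t₁ := by
    rw [hs_def]
    field_simp
    ring
  have key := measure_section_logConcave hDc hDm hs0 hs1 t₂ (-t₂)
  -- symmetry of the sections
  have hsym : (Measure.pi fun _ : Fin m => gaussianReal (0 : ℝ) (1 : ℝ≥0)) (Prod.mk (-t₂) ⁻¹' D) = (Measure.pi fun _ : Fin m => gaussianReal (0 : ℝ) (1 : ℝ≥0)) (Prod.mk t₂ ⁻¹' D) := by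
    have hset : Prod.mk (-t₂) ⁻¹' D = (fun z => -z) ⁻¹' (Prod.mk t₂ ⁻¹' D) := by
      ext z
      simp only [mem_preimage]
      constructor
      · intro hz
        simpa using hDs _ hz
      · intro hz
        simpa using hDs _ hz
    rw [hset, piGaussian_neg_preimage]
  rw [hcomb, hsym, ← ENNReal.rpow_add_of_nonneg _ _ (by linarith) hs0.le, show (1 - s) + s = 1 by ring,
    ENNReal.rpow_one] at key
  exact key

/-- The symmetric form used below: with `φ(t) = γ(D_t)`, `|t| ≤ |t'| → φ t' ≤ φ t`.
[cite: GineNickl2021, Exercise 2.4.5] -/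
theorem measure_section_anti_abs {m : ℕ} {D : Set (ℝ × (Fin m → ℝ))} (hDc : Convex ℝ D)
    (hDm : MeasurableSet D) (hDs : ∀ p ∈ D, -p ∈ D) {t t' : ℝ} (h : |t| ≤ |t'|) :
    (Measure.pi fun _ : Fin m => gaussianReal (0 : ℝ) (1 : ℝ≥0)) (Prod.mk t' ⁻¹' D) ≤ (Measure.pi fun _ : Fin m => gaussianReal (0 : ℝ) (1 : ℝ≥0)) (Prod.mk t ⁻¹' D) := by
  have heven : ∀ r : ℝ, (Measure.pi fun _ : Fin m => gaussianReal (0 : ℝ) (1 : ℝ≥0)) (Prod.mk r ⁻¹' D) = (Measure.pi fun _ : Fin m => gaussianReal (0 : ℝ) (1 : ℝ≥0)) (Prod.mk |r| ⁻¹' D) := by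
    intro r
    rcases le_or_gt 0 r with hr | hr
    · rw [abs_of_nonneg hr]
    · rw [abs_of_neg hr]
      have hset : Prod.mk r ⁻¹' D = (fun z => -z) ⁻¹' (Prod.mk (-r) ⁻¹' D) := by
        ext z
        simp only [mem_preimage]
        constructor
        · intro hz
          simpa using hDs _ hz
        · intro hz
          simpa using hDs _ hz
      rw [hset, piGaussian_neg_preimage]
  rw [heven t, heven t']
  exact measure_section_antitone hDc hDm hDs (abs_nonneg t) h

/-- **Anderson's lemma** [Anderson1955] for Gaussian vectors of the form `X = A·Z`, `Z ~ ⊗ⁿN(0,1)` (every centred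
Gaussian vector of `ℝᵏ` is of this form), GN Thm 2.4.4 with the monotone strengthening of Exercise 2.4.5: for a convex
symmetric measurable `K ⊆ ℝᵏ` and `y ∈ ℝᵏ`, `t ↦ P(A·Z + t y ∈ K)` is non-increasing on `[0,∞)`; in particular
`P(A·Z + y ∈ K) ≤ P(A·Z ∈ K)`. [cite: GineNickl2021, Theorem 2.4.4] -/
theorem anderson_piGaussian {n k : ℕ} (A : Matrix (Fin k) (Fin n) ℝ) {K : Set (Fin k → ℝ)} (hKc : Convex ℝ K)
    (hKm : MeasurableSet K) (hKs : ∀ x ∈ K, -x ∈ K) (y : Fin k → ℝ) {t₁ t₂ : ℝ} (h0 : 0 ≤ t₁) (h12 : t₁ ≤ t₂) :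
    (Measure.pi fun _ : Fin n => gaussianReal (0 : ℝ) (1 : ℝ≥0)) {z | A.mulVec z + t₂ • y ∈ K} ≤ (Measure.pi fun _ : Fin n => gaussianReal (0 : ℝ) (1 : ℝ≥0)) {z | A.mulVec z + t₁ • y ∈ K} := by
  set D : Set (ℝ × (Fin n → ℝ)) := {p | A.mulVec p.2 + p.1 • y ∈ K} with hD_def
  have hsec : ∀ t : ℝ, Prod.mk t ⁻¹' D = {z | A.mulVec z + t • y ∈ K} := fun t => rfl
  rw [← hsec, ← hsec]
  refine measure_section_antitone ?_ ?_ ?_ h0 h12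
  · intro p hp q hq a b ha hb hab
    simp only [hD_def, mem_setOf_eq, Prod.snd_add, Prod.smul_snd, Prod.fst_add, Prod.smul_fst, smul_eq_mul,
      Matrix.mulVec_add, Matrix.mulVec_smul] at hp hq ⊢
    have := hKc hp hq ha hb hab
    convert this using 1
    simp only [smul_add, add_smul, smul_smul]
    abel
  · have hcont : Continuous fun p : ℝ × (Fin n → ℝ) => A.mulVec p.2 + p.1 • y := by
      fun_prop
    exact hcont.measurable hKm
  · intro p hp
    simp only [hD_def, mem_setOf_eq, Prod.snd_neg, Prod.fst_neg, Matrix.mulVec_neg, neg_smul] at hp ⊢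
    rw [← neg_add]
    exact hKs _ hp

/-! ### Part D. The one-dimensional comparison (GN Exercise 2.4.6 / the last step of Cor. 2.4.6) -/

/-- For a probability measure `μ` on `ℝ` and `φ ≥ 0` non-increasing in `|t|`:
`μ{|t| ≤ c} · ∫ φ dμ ≤ ∫_{|t| ≤ c} φ dμ`, i.e. `E[φ | |t| ≤ c] ≥ E φ` — the printed
"`P{X ∈ A | |g₁| ≤ t} ≥ P{X ∈ A | g₁ = t}` … thus the function `f/g` is monotone decreasing".
[cite: GineNickl2021, Corollary 2.4.6 (proof)] -/
theorem setLIntegral_abs_le_ge {μ : Measure ℝ} [IsProbabilityMeasure μ] {φ : ℝ → ℝ≥0∞}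
    (hφ : ∀ t t', |t| ≤ |t'| → φ t' ≤ φ t) (c : ℝ) :
    μ {t | |t| ≤ c} * ∫⁻ t, φ t ∂μ ≤ ∫⁻ t in {t | |t| ≤ c}, φ t ∂μ := by
  set B : Set ℝ := {t | |t| ≤ c} with hB_def
  have hB : MeasurableSet B := measurableSet_le continuous_abs.measurable measurable_const
  rcases lt_or_ge c 0 with hc | hc
  · have hBe : B = ∅ := by
      ext t
      simp only [hB_def, mem_setOf_eq, mem_empty_iff_false, iff_false, not_le]
      exact hc.trans_le (abs_nonneg t)
    rw [hBe]
    simp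
  set m := φ c with hm_def
  have hin : ∀ t ∈ B, m ≤ φ t := fun t ht => hφ t c (by rw [abs_of_nonneg hc]; exact ht)
  have hout : ∀ t ∈ Bᶜ, φ t ≤ m := fun t ht => by
    have ht' : ¬ |t| ≤ c := ht
    exact hφ c t (by rw [abs_of_nonneg hc]; exact (not_le.1 ht').le)
  have h1 : m * μ B ≤ ∫⁻ t in B, φ t ∂μ := by
    calc m * μ B = ∫⁻ _ in B, m ∂μ := (setLIntegral_const B m).symm
      _ ≤ ∫⁻ t in B, φ t ∂μ := setLIntegral_mono' hB hin
  have h2 : ∫⁻ t in Bᶜ, φ t ∂μ ≤ m * μ Bᶜ := by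
    calc ∫⁻ t in Bᶜ, φ t ∂μ ≤ ∫⁻ _ in Bᶜ, m ∂μ := setLIntegral_mono' hB.compl hout
      _ = m * μ Bᶜ := setLIntegral_const _ _
  calc μ B * ∫⁻ t, φ t ∂μ = μ B * (∫⁻ t in B, φ t ∂μ + ∫⁻ t in Bᶜ, φ t ∂μ) := by
        rw [lintegral_add_compl φ hB]
    _ ≤ μ B * ∫⁻ t in B, φ t ∂μ + μ B * (m * μ Bᶜ) := by
        rw [mul_add]
        exact add_le_add le_rfl (mul_le_mul' le_rfl h2)
    _ = μ B * ∫⁻ t in B, φ t ∂μ + μ Bᶜ * (m * μ B) := by ring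
    _ ≤ μ B * ∫⁻ t in B, φ t ∂μ + μ Bᶜ * ∫⁻ t in B, φ t ∂μ :=
        add_le_add le_rfl (mul_le_mul' le_rfl h1)
    _ = (μ B + μ Bᶜ) * ∫⁻ t in B, φ t ∂μ := by ring
    _ = ∫⁻ t in B, φ t ∂μ := by rw [measure_add_measure_compl hB, measure_univ, one_mul]


/-! ### Part C. Conditioning on `⟨u, Z⟩`: rotation to the first coordinate and Tonelli
(GN Exercise 2.4.6 realised on the product space) -/

/-- Measurability of the "slab systems" `{z | u·z ∈ B ∧ ∀ j, aⱼ·z ∈ B'ⱼ}`. [folklore] -/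
private theorem measurableSet_slabSystem {n m : ℕ} (u : Fin n → ℝ) {B : Set ℝ} (hB : MeasurableSet B)
    (a : Fin m → (Fin n → ℝ)) {B' : Fin m → Set ℝ} (hB' : ∀ j, MeasurableSet (B' j)) :
    MeasurableSet {z : Fin n → ℝ | u ⬝ᵥ z ∈ B ∧ ∀ j, a j ⬝ᵥ z ∈ B' j} := by
  have hdot : ∀ w : Fin n → ℝ, Measurable fun z : Fin n → ℝ => w ⬝ᵥ z := fun w =>
    (continuous_const.dotProduct continuous_id).measurable
  have hset : {z : Fin n → ℝ | u ⬝ᵥ z ∈ B ∧ ∀ j, a j ⬝ᵥ z ∈ B' j} =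
      (fun z => u ⬝ᵥ z) ⁻¹' B ∩ ⋂ j, (fun z => a j ⬝ᵥ z) ⁻¹' B' j := by
    ext z
    simp
  rw [hset]
  exact (hdot u hB).inter (MeasurableSet.iInter fun j => hdot (a j) (hB' j))

/-- **Tonelli at coordinate `0`** for `⊗ⁿ⁺¹N(0,1) = N(0,1) ⊗ ⊗ⁿN(0,1)`: the measure of
`{z | λ z₀ ∈ B ∧ ∀ j, aⱼ·z ∈ B'ⱼ}` is `∫ 𝟙_{λt ∈ B} · ⊗ⁿN(0,1){w | ∀ j, aⱼ₀ t + a'ⱼ·w ∈ B'ⱼ} dN(0,1)(t)`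
(`aⱼ·z = aⱼ₀ z₀ + a'ⱼ·(z₁,…,zₙ)`): the product-space form of "`P{Y ∈ C | g₀ = t} = P{Z ∈ C - at}`,
`Y = a g₀ + Z`" of GN Exercise 2.4.6. [cite: GineNickl2021, Exercise 2.4.6] -/
theorem piGaussian_succ_eq_lintegral {n m : ℕ} (lam : ℝ) {B : Set ℝ} (hB : MeasurableSet B)
    (a : Fin m → (Fin (n + 1) → ℝ)) {B' : Fin m → Set ℝ} (hB' : ∀ j, MeasurableSet (B' j)) :
    (Measure.pi fun _ : Fin (n + 1) => gaussianReal (0 : ℝ) (1 : ℝ≥0)) {z | lam * z 0 ∈ B ∧ ∀ j, a j ⬝ᵥ z ∈ B' j} =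
      ∫⁻ t, {t : ℝ | lam * t ∈ B}.indicator 1 t *
        (Measure.pi fun _ : Fin n => gaussianReal (0 : ℝ) (1 : ℝ≥0)) {w | ∀ j, a j 0 * t + (fun i => a j (Fin.succ i)) ⬝ᵥ w ∈ B' j} ∂(gaussianReal 0 1) := by
  set e := MeasurableEquiv.piFinSuccAbove (fun _ : Fin (n + 1) => ℝ) 0 with he_def
  have he : MeasurePreserving e (Measure.pi fun _ : Fin (n + 1) => gaussianReal (0 : ℝ) (1 : ℝ≥0)) ((gaussianReal 0 1).prod (Measure.pi fun _ : Fin n => gaussianReal (0 : ℝ) (1 : ℝ≥0))) :=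
    measurePreserving_piFinSuccAbove (fun _ : Fin (n + 1) => gaussianReal (0 : ℝ) (1 : ℝ≥0)) 0
  set S : Set (Fin (n + 1) → ℝ) := {z | lam * z 0 ∈ B ∧ ∀ j, a j ⬝ᵥ z ∈ B' j} with hS_def
  have hSm : MeasurableSet S := by
    have h1 : S = {z : Fin (n + 1) → ℝ | Pi.single (0 : Fin (n + 1)) lam ⬝ᵥ z ∈ B ∧ ∀ j, a j ⬝ᵥ z ∈ B' j} := by
      ext z
      simp [hS_def, single_dotProduct]
    rw [h1]
    exact measurableSet_slabSystem _ hB a hB'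
  have hDt : ∀ t : ℝ, MeasurableSet {w : Fin n → ℝ | ∀ j, a j 0 * t + (fun i => a j (Fin.succ i)) ⬝ᵥ w ∈ B' j} := by
    intro t
    have hset : {w : Fin n → ℝ | ∀ j, a j 0 * t + (fun i => a j (Fin.succ i)) ⬝ᵥ w ∈ B' j} =
        ⋂ j, (fun w => a j 0 * t + (fun i => a j (Fin.succ i)) ⬝ᵥ w) ⁻¹' B' j := by
      ext w
      simp
    rw [hset]
    refine MeasurableSet.iInter fun j => ?_
    exact (measurable_const.add (continuous_const.dotProduct continuous_id).measurable) (hB' j)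
  have h0 : ∀ (t : ℝ) (w : Fin n → ℝ), e.symm (t, w) 0 = t := by
    intro t w
    simp [he_def]
  have hsucc : ∀ (t : ℝ) (w : Fin n → ℝ) (i : Fin n), e.symm (t, w) i.succ = w i := by
    intro t w i
    simp [he_def]
  have hdot : ∀ (t : ℝ) (w : Fin n → ℝ) (j : Fin m),
      a j ⬝ᵥ e.symm (t, w) = a j 0 * t + (fun i => a j (Fin.succ i)) ⬝ᵥ w := by
    intro t w j
    simp only [dotProduct, Fin.sum_univ_succ, h0, hsucc]
  have hrepr : ∀ (t : ℝ) (w : Fin n → ℝ), S.indicator (1 : (Fin (n + 1) → ℝ) → ℝ≥0∞) (e.symm (t, w)) =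
      {t : ℝ | lam * t ∈ B}.indicator 1 t *
        {w : Fin n → ℝ | ∀ j, a j 0 * t + (fun i => a j (Fin.succ i)) ⬝ᵥ w ∈ B' j}.indicator 1 w := by
    intro t w
    by_cases h1 : lam * t ∈ B
    · by_cases h2 : ∀ j, a j 0 * t + (fun i => a j (Fin.succ i)) ⬝ᵥ w ∈ B' j
      · have hmem : e.symm (t, w) ∈ S := by
          simp only [hS_def, mem_setOf_eq, h0, hdot]
          exact ⟨h1, h2⟩
        have h1' : t ∈ {t : ℝ | lam * t ∈ B} := h1
        have h2' : w ∈ {w : Fin n → ℝ | ∀ j, a j 0 * t + (fun i => a j (Fin.succ i)) ⬝ᵥ w ∈ B' j} := h2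
        rw [indicator_of_mem hmem, indicator_of_mem h1', indicator_of_mem h2']
        simp
      · have hnot : e.symm (t, w) ∉ S := by
          simp only [hS_def, mem_setOf_eq, h0, hdot, not_and]
          exact fun _ => h2
        have h2' : w ∉ {w : Fin n → ℝ | ∀ j, a j 0 * t + (fun i => a j (Fin.succ i)) ⬝ᵥ w ∈ B' j} := h2
        rw [indicator_of_notMem hnot, indicator_of_notMem h2', mul_zero]
    · have hnot : e.symm (t, w) ∉ S := by
        simp only [hS_def, mem_setOf_eq, h0, hdot, not_and]
        exact fun h => absurd h h1
      have h1' : t ∉ {t : ℝ | lam * t ∈ B} := h1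
      rw [indicator_of_notMem hnot, indicator_of_notMem h1', zero_mul]
  calc (Measure.pi fun _ : Fin (n + 1) => gaussianReal (0 : ℝ) (1 : ℝ≥0)) S = ∫⁻ z, S.indicator 1 z ∂(Measure.pi fun _ : Fin (n + 1) => gaussianReal (0 : ℝ) (1 : ℝ≥0)) := (lintegral_indicator_one hSm).symm
    _ = ∫⁻ p, S.indicator 1 (e.symm p) ∂((gaussianReal 0 1).prod (Measure.pi fun _ : Fin n => gaussianReal (0 : ℝ) (1 : ℝ≥0))) := by
        rw [← he.symm.lintegral_comp (measurable_one.indicator hSm)]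
    _ = ∫⁻ t, ∫⁻ w, S.indicator 1 (e.symm (t, w)) ∂(Measure.pi fun _ : Fin n => gaussianReal (0 : ℝ) (1 : ℝ≥0)) ∂(gaussianReal 0 1) :=
        lintegral_prod _ ((measurable_one.indicator hSm).comp e.symm.measurable).aemeasurable
    _ = ∫⁻ t, {t : ℝ | lam * t ∈ B}.indicator 1 t *
          (Measure.pi fun _ : Fin n => gaussianReal (0 : ℝ) (1 : ℝ≥0)) {w | ∀ j, a j 0 * t + (fun i => a j (Fin.succ i)) ⬝ᵥ w ∈ B' j} ∂(gaussianReal 0 1) := by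
        refine lintegral_congr fun t => ?_
        simp_rw [hrepr t]
        rw [lintegral_const_mul _ (measurable_one.indicator (hDt t)), lintegral_indicator_one (hDt t)]

/-- **Rotation**: `⊗ⁿ⁺¹N(0,1)` is invariant under the orthogonal reflection taking `u/‖u‖` to the first basis
vector (`Submodule.reflection_sub`, `stdGaussian_map`), so the slab variable `u·z` may be replaced by `‖u‖ z₀`
at the price of rotating the other functionals. [folklore] -/
private theorem piGaussian_rotate {n m : ℕ} {u : Fin (n + 1) → ℝ} (hu : u ≠ 0) (a : Fin m → (Fin (n + 1) → ℝ)) :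
    ∃ lam : ℝ, 0 < lam ∧ ∃ a' : Fin m → (Fin (n + 1) → ℝ), ∀ (B : Set ℝ), MeasurableSet B →
      ∀ (B' : Fin m → Set ℝ), (∀ j, MeasurableSet (B' j)) →
        (Measure.pi fun _ : Fin (n + 1) => gaussianReal (0 : ℝ) (1 : ℝ≥0)) {z | u ⬝ᵥ z ∈ B ∧ ∀ j, a j ⬝ᵥ z ∈ B' j} =
          (Measure.pi fun _ : Fin (n + 1) => gaussianReal (0 : ℝ) (1 : ℝ≥0)) {z | lam * z 0 ∈ B ∧ ∀ j, a' j ⬝ᵥ z ∈ B' j} := by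
  set v : EuclideanSpace ℝ (Fin (n + 1)) := toLp 2 u with hv_def
  have hv : v ≠ 0 := by
    intro h
    apply hu
    have : ofLp v = ofLp (0 : EuclideanSpace ℝ (Fin (n + 1))) := by rw [h]
    simpa [hv_def] using this
  set lam : ℝ := ‖v‖ with hlam_def
  have hlam : 0 < lam := norm_pos_iff.2 hv
  set vhat : EuclideanSpace ℝ (Fin (n + 1)) := lam⁻¹ • v with hvhat_def
  have hvhat : ‖vhat‖ = 1 := by
    rw [hvhat_def, norm_smul, norm_inv, Real.norm_of_nonneg hlam.le, hlam_def, inv_mul_cancel₀ (norm_ne_zero_iff.2 hv)]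
  set e₀ : EuclideanSpace ℝ (Fin (n + 1)) := EuclideanSpace.single 0 (1 : ℝ) with he₀_def
  have he₀ : ‖e₀‖ = 1 := by
    rw [he₀_def]
    simp [EuclideanSpace.single, PiLp.norm_single]
  set R : EuclideanSpace ℝ (Fin (n + 1)) ≃ₗᵢ[ℝ] EuclideanSpace ℝ (Fin (n + 1)) :=
    Submodule.reflection (ℝ ∙ (vhat - e₀))ᗮ with hR_def
  have hRv : R vhat = e₀ := Submodule.reflection_sub (by rw [hvhat, he₀])
  have hRsymm : R.symm = R := Submodule.reflection_symm
  have hvlam : v = lam • vhat := by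
    rw [hvhat_def, smul_smul, mul_inv_cancel₀ hlam.ne', one_smul]
  have hRv' : R v = lam • e₀ := by
    rw [hvlam, LinearIsometryEquiv.map_smul, hRv]
  refine ⟨lam, hlam, fun j => ofLp (R (toLp 2 (a j))), fun B hB B' hB' => ?_⟩
  have htoLp : Measurable (toLp 2 : (Fin (n + 1) → ℝ) → EuclideanSpace ℝ (Fin (n + 1))) :=
    (PiLp.continuous_toLp 2 _).measurable
  have hinner : ∀ w : EuclideanSpace ℝ (Fin (n + 1)), Measurable fun x : EuclideanSpace ℝ (Fin (n + 1)) =>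
      inner ℝ w x := fun w => (continuous_const.inner continuous_id).measurable
  set SE : Set (EuclideanSpace ℝ (Fin (n + 1))) :=
    {x | inner ℝ v x ∈ B ∧ ∀ j, inner ℝ (toLp 2 (a j)) x ∈ B' j} with hSE_def
  set SE' : Set (EuclideanSpace ℝ (Fin (n + 1))) :=
    {x | inner ℝ (lam • e₀) x ∈ B ∧ ∀ j, inner ℝ (R (toLp 2 (a j))) x ∈ B' j} with hSE'_def
  have hSEm : MeasurableSet SE := by
    have : SE = (fun x => inner ℝ v x) ⁻¹' B ∩ ⋂ j, (fun x => inner ℝ (toLp 2 (a j)) x) ⁻¹' B' j := by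
      ext x
      simp [hSE_def]
    rw [this]
    exact (hinner v hB).inter (MeasurableSet.iInter fun j => hinner _ (hB' j))
  have hSE'm : MeasurableSet SE' := by
    have : SE' = (fun x => inner ℝ (lam • e₀) x) ⁻¹' B ∩ ⋂ j, (fun x => inner ℝ (R (toLp 2 (a j))) x) ⁻¹' B' j := by
      ext x
      simp [hSE'_def]
    rw [this]
    exact (hinner _ hB).inter (MeasurableSet.iInter fun j => hinner _ (hB' j))
  have h1 : {z : Fin (n + 1) → ℝ | u ⬝ᵥ z ∈ B ∧ ∀ j, a j ⬝ᵥ z ∈ B' j} = (toLp 2) ⁻¹' SE := by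
    ext z
    simp only [hSE_def, hv_def, mem_setOf_eq, mem_preimage, EuclideanSpace.inner_toLp_toLp, star_trivial,
      dotProduct_comm]
  have h2 : {z : Fin (n + 1) → ℝ | lam * z 0 ∈ B ∧ ∀ j, ofLp (R (toLp 2 (a j))) ⬝ᵥ z ∈ B' j} =
      (toLp 2) ⁻¹' SE' := by
    ext z
    have k0 : inner ℝ (lam • e₀) (toLp 2 z) = lam * z 0 := by
      rw [real_inner_smul_left, he₀_def, EuclideanSpace.inner_single_left]
      simp
    have kj : ∀ j, inner ℝ (R (toLp 2 (a j))) (toLp 2 z) = ofLp (R (toLp 2 (a j))) ⬝ᵥ z := by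
      intro j
      conv_lhs => rw [← WithLp.toLp_ofLp 2 (R (toLp 2 (a j)))]
      rw [EuclideanSpace.inner_toLp_toLp, star_trivial, dotProduct_comm]
    simp only [hSE'_def, mem_setOf_eq, mem_preimage, k0, kj]
  have hpre : R ⁻¹' SE = SE' := by
    ext x
    have k1 : inner ℝ v (R x) = inner ℝ (lam • e₀) x := by
      have := R.inner_map_map (R.symm v) x
      rw [LinearIsometryEquiv.apply_symm_apply] at this
      rw [this, hRsymm, hRv']
    have k2 : ∀ j, inner ℝ (toLp 2 (a j)) (R x) = inner ℝ (R (toLp 2 (a j))) x := by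
      intro j
      have := R.inner_map_map (R.symm (toLp 2 (a j))) x
      rw [LinearIsometryEquiv.apply_symm_apply] at this
      rw [this, hRsymm]
    simp only [hSE_def, hSE'_def, mem_preimage, mem_setOf_eq, k1, k2]
  have hstd : ((Measure.pi fun _ : Fin (n + 1) => gaussianReal (0 : ℝ) (1 : ℝ≥0))).map (toLp 2) = stdGaussian (EuclideanSpace ℝ (Fin (n + 1))) := map_pi_eq_stdGaussian
  calc (Measure.pi fun _ : Fin (n + 1) => gaussianReal (0 : ℝ) (1 : ℝ≥0)) {z | u ⬝ᵥ z ∈ B ∧ ∀ j, a j ⬝ᵥ z ∈ B' j}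
      = (Measure.pi fun _ : Fin (n + 1) => gaussianReal (0 : ℝ) (1 : ℝ≥0)) ((toLp 2) ⁻¹' SE) := by rw [h1]
    _ = (((Measure.pi fun _ : Fin (n + 1) => gaussianReal (0 : ℝ) (1 : ℝ≥0))).map (toLp 2)) SE := (Measure.map_apply htoLp hSEm).symm
    _ = ((stdGaussian (EuclideanSpace ℝ (Fin (n + 1)))).map R) SE := by rw [hstd, stdGaussian_map R]
    _ = stdGaussian (EuclideanSpace ℝ (Fin (n + 1))) (R ⁻¹' SE) :=
        Measure.map_apply R.continuous.measurable hSEm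
    _ = (((Measure.pi fun _ : Fin (n + 1) => gaussianReal (0 : ℝ) (1 : ℝ≥0))).map (toLp 2)) SE' := by rw [hpre, hstd]
    _ = (Measure.pi fun _ : Fin (n + 1) => gaussianReal (0 : ℝ) (1 : ℝ≥0)) ((toLp 2) ⁻¹' SE') := Measure.map_apply htoLp hSE'm
    _ = (Measure.pi fun _ : Fin (n + 1) => gaussianReal (0 : ℝ) (1 : ℝ≥0)) {z | lam * z 0 ∈ B ∧ ∀ j, ofLp (R (toLp 2 (a j))) ⬝ᵥ z ∈ B' j} := by rw [h2]

/-! ### Part E. The Khatri–Šidák inequality and Šidák's product inequality (GN Cor. 2.4.6; [Sidak1967] Cor. 1) -/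

/-- **Khatri–Šidák inequality** (GN Cor. 2.4.6, first display; [Sidak1967] Thm 1 / [Khatri1967]) for the centred
Gaussian vector `(⟨u,Z⟩, ⟨a₁,Z⟩, …, ⟨a_m,Z⟩)`, `Z ~ ⊗ⁿN(0,1)` (every centred Gaussian vector is of this form):
`P(|⟨u,Z⟩| ≤ c) · P(|⟨aⱼ,Z⟩| ≤ dⱼ ∀ j) ≤ P(|⟨u,Z⟩| ≤ c ∧ |⟨aⱼ,Z⟩| ≤ dⱼ ∀ j)`.
[cite: GineNickl2021, Corollary 2.4.6] -/
theorem khatriSidak_pi {n m : ℕ} (u : Fin n → ℝ) (c : ℝ) (a : Fin m → (Fin n → ℝ)) (d : Fin m → ℝ) :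
    (Measure.pi fun _ : Fin n => gaussianReal (0 : ℝ) (1 : ℝ≥0)) {z | |u ⬝ᵥ z| ≤ c} * (Measure.pi fun _ : Fin n => gaussianReal (0 : ℝ) (1 : ℝ≥0)) {z | ∀ j, |a j ⬝ᵥ z| ≤ d j} ≤
      (Measure.pi fun _ : Fin n => gaussianReal (0 : ℝ) (1 : ℝ≥0)) {z | |u ⬝ᵥ z| ≤ c ∧ ∀ j, |a j ⬝ᵥ z| ≤ d j} := by
  by_cases hu : u = 0
  · subst hu
    by_cases hc : 0 ≤ c
    · have h1 : {z : Fin n → ℝ | |(0 : Fin n → ℝ) ⬝ᵥ z| ≤ c} = univ := by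
        ext z
        simp [hc]
      have h2 : {z : Fin n → ℝ | |(0 : Fin n → ℝ) ⬝ᵥ z| ≤ c ∧ ∀ j, |a j ⬝ᵥ z| ≤ d j} =
          {z | ∀ j, |a j ⬝ᵥ z| ≤ d j} := by
        ext z
        simp [hc]
      rw [h1, h2, measure_univ, one_mul]
    · have h1 : {z : Fin n → ℝ | |(0 : Fin n → ℝ) ⬝ᵥ z| ≤ c} = ∅ := by
        ext z
        simp [hc]
      rw [h1, measure_empty, zero_mul]
      exact bot_le
  obtain ⟨n', rfl⟩ : ∃ n', n = n' + 1 := by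
    rcases n with _ | n'
    · exact absurd (Subsingleton.elim u 0) hu
    · exact ⟨n', rfl⟩
  obtain ⟨lam, hlam, a', hrot⟩ := piGaussian_rotate hu a
  have hIcc : ∀ r : ℝ, MeasurableSet {x : ℝ | |x| ≤ r} := fun r =>
    measurableSet_le continuous_abs.measurable measurable_const
  set tail : Fin m → (Fin n' → ℝ) := fun j i => a' j (Fin.succ i) with htail_def
  set φ : ℝ → ℝ≥0∞ := fun t => (Measure.pi fun _ : Fin n' => gaussianReal (0 : ℝ) (1 : ℝ≥0)) {w | ∀ j, |a' j 0 * t + tail j ⬝ᵥ w| ≤ d j} with hφ_def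
  have hlamset : {t : ℝ | |lam * t| ≤ c} = {t | |t| ≤ c / lam} := by
    ext t
    simp only [mem_setOf_eq, abs_mul, abs_of_pos hlam]
    rw [le_div_iff₀ hlam, mul_comm]
  -- the joint event
  have hJ : (Measure.pi fun _ : Fin (n' + 1) => gaussianReal (0 : ℝ) (1 : ℝ≥0)) {z | |u ⬝ᵥ z| ≤ c ∧ ∀ j, |a j ⬝ᵥ z| ≤ d j} =
      ∫⁻ t, {t : ℝ | |t| ≤ c / lam}.indicator 1 t * φ t ∂(gaussianReal 0 1) := by
    have h := hrot {x | |x| ≤ c} (hIcc c) (fun j => {x | |x| ≤ d j}) fun j => hIcc (d j)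
    simp only [mem_setOf_eq] at h
    rw [h]
    have h' := piGaussian_succ_eq_lintegral lam (hIcc c) a' (B' := fun j => {x | |x| ≤ d j}) fun j => hIcc (d j)
    simp only [mem_setOf_eq] at h'
    rw [h', hlamset]
  -- the slab alone (no further constraints)
  have hS : (Measure.pi fun _ : Fin (n' + 1) => gaussianReal (0 : ℝ) (1 : ℝ≥0)) {z | |u ⬝ᵥ z| ≤ c} = (gaussianReal 0 1) {t | |t| ≤ c / lam} := by
    have h := hrot {x | |x| ≤ c} (hIcc c) (fun _ => univ) fun _ => MeasurableSet.univ
    simp only [mem_setOf_eq, mem_univ, implies_true, and_true] at h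
    rw [h]
    have h' := piGaussian_succ_eq_lintegral lam (hIcc c) a' (B' := fun _ => univ) fun _ => MeasurableSet.univ
    simp only [mem_setOf_eq, mem_univ, implies_true, and_true, setOf_true, measure_univ, mul_one] at h'
    rw [h', hlamset, lintegral_indicator_one (hIcc _)]
  -- the constraints alone (no slab)
  have hC : (Measure.pi fun _ : Fin (n' + 1) => gaussianReal (0 : ℝ) (1 : ℝ≥0)) {z | ∀ j, |a j ⬝ᵥ z| ≤ d j} = ∫⁻ t, φ t ∂(gaussianReal 0 1) := by
    have h := hrot univ MeasurableSet.univ (fun j => {x | |x| ≤ d j}) fun j => hIcc (d j)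
    simp only [mem_setOf_eq, mem_univ, true_and] at h
    rw [h]
    have h' := piGaussian_succ_eq_lintegral lam MeasurableSet.univ a' (B' := fun j => {x | |x| ≤ d j})
      fun j => hIcc (d j)
    simp only [mem_setOf_eq, mem_univ, true_and, setOf_true, indicator_univ, Pi.one_apply, one_mul] at h'
    rw [h']
  -- `φ` is non-increasing in `|t|` (GN Thm 2.4.3 / Ex. 2.4.5 on the convex symmetric slab system)
  have hφanti : ∀ t t' : ℝ, |t| ≤ |t'| → φ t' ≤ φ t := by
    intro t t' htt'
    set D : Set (ℝ × (Fin n' → ℝ)) := {p | ∀ j, |a' j 0 * p.1 + tail j ⬝ᵥ p.2| ≤ d j} with hD_def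
    have hsec : ∀ r : ℝ, φ r = (Measure.pi fun _ : Fin n' => gaussianReal (0 : ℝ) (1 : ℝ≥0)) (Prod.mk r ⁻¹' D) := fun r => rfl
    rw [hsec, hsec]
    refine measure_section_anti_abs ?_ ?_ ?_ htt'
    · intro p hp q hq α β hα hβ hαβ j
      have hp' := hp j
      have hq' := hq j
      have hlin : a' j 0 * (α • p + β • q).1 + tail j ⬝ᵥ (α • p + β • q).2 =
          α * (a' j 0 * p.1 + tail j ⬝ᵥ p.2) + β * (a' j 0 * q.1 + tail j ⬝ᵥ q.2) := by
        simp only [Prod.fst_add, Prod.smul_fst, Prod.snd_add, Prod.smul_snd, smul_eq_mul, dotProduct_add,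
          dotProduct_smul]
        ring
      rw [hlin]
      calc |α * (a' j 0 * p.1 + tail j ⬝ᵥ p.2) + β * (a' j 0 * q.1 + tail j ⬝ᵥ q.2)|
          ≤ |α * (a' j 0 * p.1 + tail j ⬝ᵥ p.2)| + |β * (a' j 0 * q.1 + tail j ⬝ᵥ q.2)| := abs_add_le _ _
        _ = α * |a' j 0 * p.1 + tail j ⬝ᵥ p.2| + β * |a' j 0 * q.1 + tail j ⬝ᵥ q.2| := by
            rw [abs_mul, abs_mul, abs_of_nonneg hα, abs_of_nonneg hβ]
        _ ≤ α * d j + β * d j := add_le_add (mul_le_mul_of_nonneg_left hp' hα) (mul_le_mul_of_nonneg_left hq' hβ)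
        _ = d j := by rw [← add_mul, hαβ, one_mul]
    · have hset : D = ⋂ j, {p : ℝ × (Fin n' → ℝ) | |a' j 0 * p.1 + tail j ⬝ᵥ p.2| ≤ d j} := by
        ext p
        simp [hD_def]
      rw [hset]
      refine MeasurableSet.iInter fun j => measurableSet_le ?_ measurable_const
      exact ((measurable_const.mul measurable_fst).add
        ((continuous_const.dotProduct continuous_snd).measurable)).abs
    · intro p hp j
      have := hp j
      simp only [Prod.fst_neg, Prod.snd_neg, mul_neg, dotProduct_neg, ← neg_add, abs_neg]
      exact this
  -- assemble (GN: "`P{X ∈ A | |g₁| ≤ t} ≥ P{X ∈ A | g₁ = t}`")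
  calc (Measure.pi fun _ : Fin (n' + 1) => gaussianReal (0 : ℝ) (1 : ℝ≥0)) {z | |u ⬝ᵥ z| ≤ c} * (Measure.pi fun _ : Fin (n' + 1) => gaussianReal (0 : ℝ) (1 : ℝ≥0)) {z | ∀ j, |a j ⬝ᵥ z| ≤ d j}
      = (gaussianReal 0 1) {t | |t| ≤ c / lam} * ∫⁻ t, φ t ∂(gaussianReal 0 1) := by rw [hS, hC]
    _ ≤ ∫⁻ t in {t | |t| ≤ c / lam}, φ t ∂(gaussianReal 0 1) := setLIntegral_abs_le_ge hφanti (c / lam)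
    _ = ∫⁻ t, {t : ℝ | |t| ≤ c / lam}.indicator 1 t * φ t ∂(gaussianReal 0 1) := by
        rw [← lintegral_indicator (hIcc _)]
        refine lintegral_congr fun t => ?_
        by_cases ht : t ∈ {t : ℝ | |t| ≤ c / lam}
        · rw [indicator_of_mem ht, indicator_of_mem ht, Pi.one_apply, one_mul]
        · rw [indicator_of_notMem ht, indicator_of_notMem ht, zero_mul]
    _ = (Measure.pi fun _ : Fin (n' + 1) => gaussianReal (0 : ℝ) (1 : ℝ≥0)) {z | |u ⬝ᵥ z| ≤ c ∧ ∀ j, |a j ⬝ᵥ z| ≤ d j} := hJ.symm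

/-- **Šidák's inequality** ([Sidak1967] Corollary 1; GN Cor. 2.4.6, second display, "iterating") for the centred
Gaussian vector `(⟨a₁,Z⟩, …, ⟨a_m,Z⟩)`, `Z ~ ⊗ⁿN(0,1)`, with one threshold per coordinate:
`∏ⱼ P(|⟨aⱼ,Z⟩| ≤ dⱼ) ≤ P(|⟨aⱼ,Z⟩| ≤ dⱼ ∀ j)`. [cite: Sidak1967, Corollary 1] -/
theorem sidak_pi {n : ℕ} : ∀ (m : ℕ) (a : Fin m → (Fin n → ℝ)) (d : Fin m → ℝ),
    ∏ j, (Measure.pi fun _ : Fin n => gaussianReal (0 : ℝ) (1 : ℝ≥0)) {z | |a j ⬝ᵥ z| ≤ d j} ≤ (Measure.pi fun _ : Fin n => gaussianReal (0 : ℝ) (1 : ℝ≥0)) {z | ∀ j, |a j ⬝ᵥ z| ≤ d j}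
  | 0, a, d => by simp
  | m + 1, a, d => by
    rw [Fin.prod_univ_succ]
    have hsplit : {z : Fin n → ℝ | ∀ j, |a j ⬝ᵥ z| ≤ d j} =
        {z | |a 0 ⬝ᵥ z| ≤ d 0 ∧ ∀ j : Fin m, |a j.succ ⬝ᵥ z| ≤ d j.succ} := by
      ext z
      simp only [mem_setOf_eq, Fin.forall_fin_succ]
    rw [hsplit]
    calc (Measure.pi fun _ : Fin n => gaussianReal (0 : ℝ) (1 : ℝ≥0)) {z | |a 0 ⬝ᵥ z| ≤ d 0} * ∏ j : Fin m, (Measure.pi fun _ : Fin n => gaussianReal (0 : ℝ) (1 : ℝ≥0)) {z | |a j.succ ⬝ᵥ z| ≤ d j.succ}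
        ≤ (Measure.pi fun _ : Fin n => gaussianReal (0 : ℝ) (1 : ℝ≥0)) {z | |a 0 ⬝ᵥ z| ≤ d 0} * (Measure.pi fun _ : Fin n => gaussianReal (0 : ℝ) (1 : ℝ≥0)) {z | ∀ j : Fin m, |a j.succ ⬝ᵥ z| ≤ d j.succ} :=
          mul_le_mul' le_rfl (sidak_pi m (fun j => a j.succ) fun j => d j.succ)
      _ ≤ (Measure.pi fun _ : Fin n => gaussianReal (0 : ℝ) (1 : ℝ≥0)) {z | |a 0 ⬝ᵥ z| ≤ d 0 ∧ ∀ j : Fin m, |a j.succ ⬝ᵥ z| ≤ d j.succ} :=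
          khatriSidak_pi (a 0) (d 0) (fun j => a j.succ) fun j => d j.succ

/-! ### Part F. The form for Mathlib's `multivariateGaussian 0 S` with coordinate slabs -/

/-- `N(0, S) = (⊗ᵏN(0,1)).map (z ↦ √S z)`: Mathlib's `multivariateGaussian 0 S` is the image of the product standard
Gaussian under the matrix `CFC.sqrt S` (by `map_pi_eq_stdGaussian` and the definition). [folklore] -/
private theorem multivariateGaussian_zero_eq_map_pi {k : ℕ} (S : Matrix (Fin k) (Fin k) ℝ) :
    multivariateGaussian 0 S = ((Measure.pi fun _ : Fin k => gaussianReal (0 : ℝ) (1 : ℝ≥0))).map (fun z => toLp 2 ((CFC.sqrt S).mulVec z)) := by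
  have htoLp : Measurable (toLp 2 : (Fin k → ℝ) → EuclideanSpace ℝ (Fin k)) :=
    (PiLp.continuous_toLp 2 _).measurable
  have hT : Measurable fun x : EuclideanSpace ℝ (Fin k) =>
      (0 : EuclideanSpace ℝ (Fin k)) + Matrix.toEuclideanCLM (𝕜 := ℝ) (CFC.sqrt S) x :=
    (continuous_const.add (Matrix.toEuclideanCLM (𝕜 := ℝ) (CFC.sqrt S)).continuous).measurable
  rw [multivariateGaussian, ← map_pi_eq_stdGaussian, Measure.map_map hT htoLp]
  congr 1
  funext z
  simp [Function.comp, Matrix.toEuclideanCLM_toLp]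

/-- **Šidák's inequality for `N(0, S)`** (Mathlib's `multivariateGaussian 0 S`, any `k × k` real matrix `S`) and
coordinate slabs with one threshold per coordinate: `∏ᵢ P(|xᵢ| ≤ pᵢ) ≤ P(|xᵢ| ≤ pᵢ ∀ i)`.
[cite: Sidak1967, Corollary 1] -/
theorem sidak_multivariateGaussian {k : ℕ} (S : Matrix (Fin k) (Fin k) ℝ) (p : Fin k → ℝ) :
    ∏ i, (multivariateGaussian 0 S) {x | |x i| ≤ p i} ≤ (multivariateGaussian 0 S) {x | ∀ i, |x i| ≤ p i} := by
  have hmeas : Measurable fun z : Fin k → ℝ => toLp 2 ((CFC.sqrt S).mulVec z) :=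
    (PiLp.continuous_toLp 2 _).measurable.comp (Continuous.matrix_mulVec continuous_const continuous_id).measurable
  have hcoord : ∀ i : Fin k, Measurable fun x : EuclideanSpace ℝ (Fin k) => x i := fun i =>
    (PiLp.continuous_apply 2 _ i).measurable
  have hAi : ∀ i : Fin k, MeasurableSet {x : EuclideanSpace ℝ (Fin k) | |x i| ≤ p i} := fun i =>
    measurableSet_le (hcoord i).abs measurable_const
  have hA : MeasurableSet {x : EuclideanSpace ℝ (Fin k) | ∀ i, |x i| ≤ p i} := by
    have : {x : EuclideanSpace ℝ (Fin k) | ∀ i, |x i| ≤ p i} = ⋂ i, {x | |x i| ≤ p i} := by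
      ext x
      simp
    rw [this]
    exact MeasurableSet.iInter hAi
  rw [multivariateGaussian_zero_eq_map_pi, Measure.map_apply hmeas hA]
  have hprod : ∏ i, (((Measure.pi fun _ : Fin k => gaussianReal (0 : ℝ) (1 : ℝ≥0))).map fun z => toLp 2 ((CFC.sqrt S).mulVec z)) {x | |x i| ≤ p i} =
      ∏ i, (Measure.pi fun _ : Fin k => gaussianReal (0 : ℝ) (1 : ℝ≥0)) {z | |(CFC.sqrt S) i ⬝ᵥ z| ≤ p i} := by
    refine Finset.prod_congr rfl fun i _ => ?_
    rw [Measure.map_apply hmeas (hAi i)]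
    rfl
  rw [hprod]
  exact sidak_pi k (fun i => (CFC.sqrt S) i) p

/-- The same in Mathlib's `Measure.real` form (all probabilities are finite). [cite: Sidak1967, Corollary 1] -/
theorem sidak_multivariateGaussian_real {k : ℕ} (S : Matrix (Fin k) (Fin k) ℝ) (p : Fin k → ℝ) :
    ∏ i, (multivariateGaussian 0 S).real {x | |x i| ≤ p i} ≤
      (multivariateGaussian 0 S).real {x | ∀ i, |x i| ≤ p i} := by
  simp only [measureReal_def, ← ENNReal.toReal_prod]
  exact ENNReal.toReal_mono (measure_ne_top _ _) (sidak_multivariateGaussian S p)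

/-! ### Part G (v1.1). General centred Gaussian laws on `ℝᵏ` — "jointly normal centred random variables"
([Sidak1967] Cor. 1 and GN Cor. 2.4.6 as printed) -/

/-- A centred Gaussian measure on `EuclideanSpace ℝ (Fin k)` is Mathlib's `multivariateGaussian 0 S` for its covariance
matrix `S i j = Cov(xᵢ, xⱼ)` in the standard basis (Gaussian measures are determined by mean and covariance,
`IsGaussian.ext`; cf. GN p. 49 "μ is supported by a subspace V … with density ce^{-|Γx|²/2}"). [folklore] -/
private theorem eq_multivariateGaussian_of_isGaussian {k : ℕ} (μ : Measure (EuclideanSpace ℝ (Fin k)))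
    [IsGaussian μ] (h0 : ∫ x, x ∂μ = 0) :
    μ = multivariateGaussian 0 (Matrix.of fun i j : Fin k =>
      covarianceBilin μ (EuclideanSpace.single i (1 : ℝ)) (EuclideanSpace.single j (1 : ℝ))) := by
  set e : Fin k → EuclideanSpace ℝ (Fin k) := fun i => EuclideanSpace.single i (1 : ℝ) with he_def
  set S : Matrix (Fin k) (Fin k) ℝ := Matrix.of fun i j : Fin k => covarianceBilin μ (e i) (e j) with hS_def
  have hsum : ∀ x : EuclideanSpace ℝ (Fin k), ∑ i, x i • e i = x := by
    intro x
    have h := (EuclideanSpace.basisFun (Fin k) ℝ).sum_repr x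
    simpa [he_def, EuclideanSpace.basisFun_apply] using h
  have hexp : ∀ x y : EuclideanSpace ℝ (Fin k), covarianceBilin μ x y = ofLp x ⬝ᵥ S.mulVec (ofLp y) := by
    intro x y
    conv_lhs => rw [← hsum x, ← hsum y]
    simp only [map_sum, map_smul, FunLike.coe_sum, FunLike.coe_smul, Finset.sum_apply, Pi.smul_apply,
      smul_eq_mul]
    simp only [dotProduct, Matrix.mulVec, hS_def, Matrix.of_apply, Finset.mul_sum]
    rw [Finset.sum_comm]
    refine Finset.sum_congr rfl fun i _ => Finset.sum_congr rfl fun j _ => ?_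
    ring
  have hS : S.PosSemidef := by
    refine Matrix.PosSemidef.of_dotProduct_mulVec_nonneg ?_ ?_
    · refine Matrix.IsHermitian.ext fun i j => ?_
      simp only [hS_def, Matrix.of_apply, star_trivial]
      exact covarianceBilin_comm _ _
    · intro x
      rw [star_trivial]
      have h := hexp (toLp 2 x) (toLp 2 x)
      rw [← h]
      exact covarianceBilin_self_nonneg _
  refine IsGaussian.ext ?_ ?_
  · rw [integral_id_multivariateGaussian']
    simpa using h0
  · ext x y
    rw [covarianceBilin_multivariateGaussian hS, hexp]

/-- **Šidák's inequality for an arbitrary centred Gaussian measure on `ℝᵏ`** ([Sidak1967] Corollary 1; GN Cor. 2.4.6,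
second display): `∏ᵢ μ{|xᵢ| ≤ pᵢ} ≤ μ{|xᵢ| ≤ pᵢ ∀ i}`. [cite: Sidak1967, Corollary 1] -/
theorem sidak_of_isGaussian {k : ℕ} (μ : Measure (EuclideanSpace ℝ (Fin k))) [IsGaussian μ]
    (h0 : ∫ x, x ∂μ = 0) (p : Fin k → ℝ) :
    ∏ i, μ {x | |x i| ≤ p i} ≤ μ {x | ∀ i, |x i| ≤ p i} := by
  rw [eq_multivariateGaussian_of_isGaussian μ h0]
  exact sidak_multivariateGaussian _ p

/-- **The Khatri–Šidák inequality for `N(0, S)`** (Mathlib's `multivariateGaussian 0 S`, any real `S`), coordinate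
form: `P(|x₀| ≤ c) · P(|x_{j+1}| ≤ dⱼ ∀ j) ≤ P(|x₀| ≤ c ∧ |x_{j+1}| ≤ dⱼ ∀ j)`. [cite: GineNickl2021, Corollary 2.4.6] -/
theorem khatriSidak_multivariateGaussian {m : ℕ} (S : Matrix (Fin (m + 1)) (Fin (m + 1)) ℝ) (c : ℝ)
    (d : Fin m → ℝ) :
    (multivariateGaussian 0 S) {x | |x 0| ≤ c} * (multivariateGaussian 0 S) {x | ∀ j : Fin m, |x j.succ| ≤ d j} ≤
      (multivariateGaussian 0 S) {x | |x 0| ≤ c ∧ ∀ j : Fin m, |x j.succ| ≤ d j} := by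
  have hmeas : Measurable fun z : Fin (m + 1) → ℝ => toLp 2 ((CFC.sqrt S).mulVec z) :=
    (PiLp.continuous_toLp 2 _).measurable.comp (Continuous.matrix_mulVec continuous_const continuous_id).measurable
  have hcoord : ∀ i : Fin (m + 1), Measurable fun x : EuclideanSpace ℝ (Fin (m + 1)) => x i := fun i =>
    (PiLp.continuous_apply 2 _ i).measurable
  have h0m : MeasurableSet {x : EuclideanSpace ℝ (Fin (m + 1)) | |x 0| ≤ c} :=
    measurableSet_le (hcoord 0).abs measurable_const
  have hCm : MeasurableSet {x : EuclideanSpace ℝ (Fin (m + 1)) | ∀ j : Fin m, |x j.succ| ≤ d j} := by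
    have : {x : EuclideanSpace ℝ (Fin (m + 1)) | ∀ j : Fin m, |x j.succ| ≤ d j} = ⋂ j, {x | |x j.succ| ≤ d j} := by
      ext x
      simp
    rw [this]
    exact MeasurableSet.iInter fun j => measurableSet_le (hcoord _).abs measurable_const
  have hJm : MeasurableSet {x : EuclideanSpace ℝ (Fin (m + 1)) | |x 0| ≤ c ∧ ∀ j : Fin m, |x j.succ| ≤ d j} :=
    h0m.inter hCm
  rw [multivariateGaussian_zero_eq_map_pi, Measure.map_apply hmeas h0m, Measure.map_apply hmeas hCm,
    Measure.map_apply hmeas hJm]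
  exact khatriSidak_pi ((CFC.sqrt S) 0) c (fun j => (CFC.sqrt S) j.succ) d

/-- **The Khatri–Šidák inequality for an arbitrary centred Gaussian measure on `ℝᵐ⁺¹`**, coordinate form.
[cite: GineNickl2021, Corollary 2.4.6] -/
theorem khatriSidak_of_isGaussian {m : ℕ} (μ : Measure (EuclideanSpace ℝ (Fin (m + 1)))) [IsGaussian μ]
    (h0 : ∫ x, x ∂μ = 0) (c : ℝ) (d : Fin m → ℝ) :
    μ {x | |x 0| ≤ c} * μ {x | ∀ j : Fin m, |x j.succ| ≤ d j} ≤ μ {x | |x 0| ≤ c ∧ ∀ j : Fin m, |x j.succ| ≤ d j} := by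
  rw [eq_multivariateGaussian_of_isGaussian μ h0]
  exact khatriSidak_multivariateGaussian _ c d

/-- **Šidák's inequality for jointly normal centred random variables** `X₁, …, X_k` on a probability space
([Sidak1967] Corollary 1 as printed — "jointly Gaussian mean zero random variables" in the quotation of
[SchechtmanSchlumprechtZinn1998] p. 347; GN Cor. 2.4.6 "iterating"): `∏ᵢ P(|Xᵢ| ≤ pᵢ) ≤ P(|Xᵢ| ≤ pᵢ ∀ i)`.  Joint
normality = Mathlib's `HasGaussianLaw` of the vector `ω ↦ (Xᵢ ω)ᵢ`. [cite: Sidak1967, Corollary 1] -/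
theorem sidak_of_hasGaussianLaw {Ω : Type*} [MeasurableSpace Ω] {P : Measure Ω} [IsProbabilityMeasure P] {k : ℕ}
    {X : Fin k → Ω → ℝ} (hX : HasGaussianLaw (fun ω i => X i ω) P) (h0 : ∀ i, ∫ ω, X i ω ∂P = 0)
    (p : Fin k → ℝ) :
    ∏ i, P {ω | |X i ω| ≤ p i} ≤ P {ω | ∀ i, |X i ω| ≤ p i} := by
  set L : (Fin k → ℝ) →L[ℝ] EuclideanSpace ℝ (Fin k) :=
    (EuclideanSpace.equiv (Fin k) ℝ).symm.toContinuousLinearMap with hL_def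
  set Y : Ω → EuclideanSpace ℝ (Fin k) := fun ω => L (fun i => X i ω) with hY_def
  have hY : HasGaussianLaw Y P := hX.map L
  haveI : IsGaussian (P.map Y) := hY.isGaussian_map
  have hYae : AEMeasurable Y P := hY.aemeasurable
  have hYi : ∀ ω i, Y ω i = X i ω := fun ω i => rfl
  have hmean : ∫ y, y ∂(P.map Y) = 0 := by
    have hint : Integrable (fun y : EuclideanSpace ℝ (Fin k) => y) (P.map Y) := IsGaussian.integrable_id
    rw [integral_map hYae hint.aestronglyMeasurable]
    have hYint : Integrable Y P := hint.comp_aemeasurable hYae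
    ext i
    rw [show (∫ ω, Y ω ∂P) i = EuclideanSpace.proj (𝕜 := ℝ) i (∫ ω, Y ω ∂P) from rfl,
      ← ContinuousLinearMap.integral_comp_comm _ hYint]
    have : (fun ω => EuclideanSpace.proj (𝕜 := ℝ) i (Y ω)) = fun ω => X i ω := by
      funext ω
      exact hYi ω i
    rw [this, h0 i]
    rfl
  have key := sidak_of_isGaussian (P.map Y) hmean p
  have hcoord : ∀ i : Fin k, Measurable fun x : EuclideanSpace ℝ (Fin k) => x i := fun i =>
    (PiLp.continuous_apply 2 _ i).measurable
  have hAi : ∀ i : Fin k, MeasurableSet {x : EuclideanSpace ℝ (Fin k) | |x i| ≤ p i} := fun i =>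
    measurableSet_le (hcoord i).abs measurable_const
  have hA : MeasurableSet {x : EuclideanSpace ℝ (Fin k) | ∀ i, |x i| ≤ p i} := by
    have : {x : EuclideanSpace ℝ (Fin k) | ∀ i, |x i| ≤ p i} = ⋂ i, {x | |x i| ≤ p i} := by
      ext x
      simp
    rw [this]
    exact MeasurableSet.iInter hAi
  rw [Measure.map_apply_of_aemeasurable hYae hA] at key
  have hprod : ∏ i, (P.map Y) {x | |x i| ≤ p i} = ∏ i, P {ω | |X i ω| ≤ p i} := by
    refine Finset.prod_congr rfl fun i _ => ?_
    rw [Measure.map_apply_of_aemeasurable hYae (hAi i)]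
    rfl
  rw [hprod] at key
  exact key

/-- **The Khatri–Šidák inequality for jointly normal centred random variables** `(X₀, X₁, …, X_m)` (GN Cor. 2.4.6,
first display; [Khatri1967]): `P(|X₀| ≤ c) · P(|Xⱼ₊₁| ≤ dⱼ ∀ j) ≤ P(|X₀| ≤ c ∧ |Xⱼ₊₁| ≤ dⱼ ∀ j)`.
[cite: GineNickl2021, Corollary 2.4.6] -/
theorem khatriSidak_of_hasGaussianLaw {Ω : Type*} [MeasurableSpace Ω] {P : Measure Ω} [IsProbabilityMeasure P]
    {m : ℕ} {X : Fin (m + 1) → Ω → ℝ} (hX : HasGaussianLaw (fun ω i => X i ω) P) (h0 : ∀ i, ∫ ω, X i ω ∂P = 0)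
    (c : ℝ) (d : Fin m → ℝ) :
    P {ω | |X 0 ω| ≤ c} * P {ω | ∀ j : Fin m, |X j.succ ω| ≤ d j} ≤
      P {ω | |X 0 ω| ≤ c ∧ ∀ j : Fin m, |X j.succ ω| ≤ d j} := by
  set L : (Fin (m + 1) → ℝ) →L[ℝ] EuclideanSpace ℝ (Fin (m + 1)) :=
    (EuclideanSpace.equiv (Fin (m + 1)) ℝ).symm.toContinuousLinearMap with hL_def
  set Y : Ω → EuclideanSpace ℝ (Fin (m + 1)) := fun ω => L (fun i => X i ω) with hY_def
  have hY : HasGaussianLaw Y P := hX.map L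
  haveI : IsGaussian (P.map Y) := hY.isGaussian_map
  have hYae : AEMeasurable Y P := hY.aemeasurable
  have hYi : ∀ ω i, Y ω i = X i ω := fun ω i => rfl
  have hmean : ∫ y, y ∂(P.map Y) = 0 := by
    have hint : Integrable (fun y : EuclideanSpace ℝ (Fin (m + 1)) => y) (P.map Y) := IsGaussian.integrable_id
    rw [integral_map hYae hint.aestronglyMeasurable]
    have hYint : Integrable Y P := hint.comp_aemeasurable hYae
    ext i
    rw [show (∫ ω, Y ω ∂P) i = EuclideanSpace.proj (𝕜 := ℝ) i (∫ ω, Y ω ∂P) from rfl,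
      ← ContinuousLinearMap.integral_comp_comm _ hYint]
    have : (fun ω => EuclideanSpace.proj (𝕜 := ℝ) i (Y ω)) = fun ω => X i ω := by
      funext ω
      exact hYi ω i
    rw [this, h0 i]
    rfl
  have key := khatriSidak_of_isGaussian (P.map Y) hmean c d
  have hcoord : ∀ i : Fin (m + 1), Measurable fun x : EuclideanSpace ℝ (Fin (m + 1)) => x i := fun i =>
    (PiLp.continuous_apply 2 _ i).measurable
  have h0m : MeasurableSet {x : EuclideanSpace ℝ (Fin (m + 1)) | |x 0| ≤ c} :=
    measurableSet_le (hcoord 0).abs measurable_const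
  have hCm : MeasurableSet {x : EuclideanSpace ℝ (Fin (m + 1)) | ∀ j : Fin m, |x j.succ| ≤ d j} := by
    have : {x : EuclideanSpace ℝ (Fin (m + 1)) | ∀ j : Fin m, |x j.succ| ≤ d j} = ⋂ j, {x | |x j.succ| ≤ d j} := by
      ext x
      simp
    rw [this]
    exact MeasurableSet.iInter fun j => measurableSet_le (hcoord _).abs measurable_const
  have hJm : MeasurableSet {x : EuclideanSpace ℝ (Fin (m + 1)) | |x 0| ≤ c ∧ ∀ j : Fin m, |x j.succ| ≤ d j} :=
    h0m.inter hCm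
  rw [Measure.map_apply_of_aemeasurable hYae h0m, Measure.map_apply_of_aemeasurable hYae hCm,
    Measure.map_apply_of_aemeasurable hYae hJm] at key
  exact key

/-! ### Part H (v1.2). Anderson's lemma for an arbitrary centred Gaussian measure on `ℝᵏ` (GN Thm 2.4.4 and
Exercise 2.4.5 as printed) -/

/-- **Anderson's lemma, monotone form** (GN Exercise 2.4.5 for Thm 2.4.4; [Anderson1955]): for a centred Gaussian
measure `μ` on `EuclideanSpace ℝ (Fin k)` (the law of "a centred jointly normal vector `X` in `ℝᵏ`"), a measurable convex
symmetric `C` and `y`, `t ↦ μ{x | x + t•y ∈ C} = P(X + t y ∈ C)` is non-increasing on `[0, ∞)`.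
[cite: GineNickl2021, Exercise 2.4.5] -/
theorem anderson_of_isGaussian_antitone {k : ℕ} (μ : Measure (EuclideanSpace ℝ (Fin k))) [IsGaussian μ]
    (h0 : ∫ x, x ∂μ = 0) {C : Set (EuclideanSpace ℝ (Fin k))} (hCc : Convex ℝ C) (hCm : MeasurableSet C)
    (hCs : ∀ x ∈ C, -x ∈ C) (y : EuclideanSpace ℝ (Fin k)) {t₁ t₂ : ℝ} (ht0 : 0 ≤ t₁) (h12 : t₁ ≤ t₂) :
    μ {x | x + t₂ • y ∈ C} ≤ μ {x | x + t₁ • y ∈ C} := by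
  rw [eq_multivariateGaussian_of_isGaussian μ h0, multivariateGaussian_zero_eq_map_pi]
  set A : Matrix (Fin k) (Fin k) ℝ := CFC.sqrt (Matrix.of fun i j : Fin k =>
    covarianceBilin μ (EuclideanSpace.single i (1 : ℝ)) (EuclideanSpace.single j (1 : ℝ))) with hA_def
  have hmeas : Measurable fun z : Fin k → ℝ => toLp 2 (A.mulVec z) :=
    (PiLp.continuous_toLp 2 _).measurable.comp (Continuous.matrix_mulVec continuous_const continuous_id).measurable
  have htoLp : Measurable (toLp 2 : (Fin k → ℝ) → EuclideanSpace ℝ (Fin k)) := (PiLp.continuous_toLp 2 _).measurable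
  have hT : ∀ t : ℝ, MeasurableSet {x : EuclideanSpace ℝ (Fin k) | x + t • y ∈ C} := fun t =>
    (measurable_id.add_const _) hCm
  rw [Measure.map_apply hmeas (hT t₂), Measure.map_apply hmeas (hT t₁)]
  -- pull `C` back to the product coordinates
  set K : Set (Fin k → ℝ) := (toLp 2) ⁻¹' C with hK_def
  have hKc : Convex ℝ K := by
    intro p hp q hq a b ha hb hab
    have h := hCc hp hq ha hb hab
    simpa [hK_def, mem_preimage, toLp_add, toLp_smul] using h
  have hKm : MeasurableSet K := htoLp hCm
  have hKs : ∀ x ∈ K, -x ∈ K := by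
    intro x hx
    have h := hCs _ hx
    simpa [hK_def, mem_preimage, toLp_neg] using h
  have hpre : ∀ t : ℝ, (fun z : Fin k → ℝ => toLp 2 (A.mulVec z)) ⁻¹' {x : EuclideanSpace ℝ (Fin k) | x + t • y ∈ C} =
      {z | A.mulVec z + t • ofLp y ∈ K} := by
    intro t
    ext z
    simp only [mem_preimage, mem_setOf_eq, hK_def, toLp_add, toLp_smul, toLp_ofLp]
  rw [hpre, hpre]
  exact anderson_piGaussian A hKc hKm hKs (ofLp y) ht0 h12

/-- **Anderson's lemma** (GN Thm 2.4.4; [Anderson1955]): for a centred Gaussian measure `μ` on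
`EuclideanSpace ℝ (Fin k)`, a measurable convex symmetric `C` and every `y`, `μ(C - y) = P(X + y ∈ C) ≤ P(X ∈ C) = μ(C)`.
[cite: GineNickl2021, Theorem 2.4.4] -/
theorem anderson_of_isGaussian {k : ℕ} (μ : Measure (EuclideanSpace ℝ (Fin k))) [IsGaussian μ]
    (h0 : ∫ x, x ∂μ = 0) {C : Set (EuclideanSpace ℝ (Fin k))} (hCc : Convex ℝ C) (hCm : MeasurableSet C)
    (hCs : ∀ x ∈ C, -x ∈ C) (y : EuclideanSpace ℝ (Fin k)) :
    μ {x | x + y ∈ C} ≤ μ C := by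
  have h := anderson_of_isGaussian_antitone μ h0 hCc hCm hCs y le_rfl zero_le_one
  simpa only [one_smul, zero_smul, add_zero, setOf_mem_eq] using h

end Literature.Probability.Distributions.KhatriSidak
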